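import Summits.Ventures.PercRepro.RankLevelSetRuleQSliceBorderClimb
import Summits.Ventures.PercRepro.RankLevelSetRuleQSliceFirstUntruncTwo
import Summits.Ventures.PercRepro.RankLevelSetRuleQSliceMapsAllD
import Summits.Ventures.PercRepro.RankLevelSetRuleQRhat

/-!
# PercRepro — THE FIRST UNTRUNCATED SLICE `u = k − 1` ON EVERY CELL OF EVERY FAMILY (night-1, gen 22; dossier §33)

The slice `u = k − 1` is paid on its bottom regime `k − 1 ≤ q ≤ k² − 1` (`first_untrunc_slice_complete`, gen 21) and, for
`k ≤ 10`, on every cell (`rhat_slice_iff_all_ten`). The large-q half `q ≥ k²` for every `k ≥ 11` is the climb of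
RankLevelSetRuleQSliceBorderClimb, whose explicit inequality (FIN) is proved here:
* `fin_nine` (`k = 11`, `m ≥ 111`): `9·(2J_2) ≤ 4/5` and `C(20,10)·(1 + q/100)/C(m+5, 4) ≤ 1/5`;
* `tK` — the `k`-recursion `54·C(2K+2, K+1)·d ≤ (K+1)²·C(K² + 3K + 3 + d, d − 1)` (`d = ⌊K/2⌋`, `K ≥ 10`) by a two-step
  induction (`C(2K+2, K+1)` grows by `< 16·6/5` per `K ↦ K + 2`, the right binomial by `≥ 2K + 6`);
* `fin_ten_up` (`k ≥ 12`, `m ≥ k² − k + 1`): `K·(2J_2) ≤ 17/18` and the right side of (FIN) is `≤ 1/18` through `tK`;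
* **`first_untrunc_large`** — `Φ(q+k, q) ≤ R̂(q, k, q − (k−1))` for `k ≥ 11`, `q ≥ k²`;
* **`first_untrunc_slice_every`** — THE FIRST UNTRUNCATED SLICE IS PAID ON EVERY CELL `q ≥ k − 1` OF EVERY FAMILY `k ≥ 5`
  (`rhat_first_untrunc_slice` is its slice-map form);
* **`ruleQRecv_ge_phiK_first_untrunc_every`** — the matroid level: at the tight layer `#E = (q+k) + q` of every finite matroid,
  every member `Z` of the cell `(q+k, q)` with `#(flatPart M Z) = q − (k − 1)` receives at least `Φ(q+k, q)` under Rule Q's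
  equal split, for every `k ≥ 5` and every `q ≥ k − 1`.
Twins: mining/night-1/g22/ (exact: the step from `m ≈ 10`, the margins of (FIN) at `m = k² − k + 1`). Axioms: standard.
-/

namespace PercRepro

open Finset

/-! ### §3 The explicit inequality (FIN) -/

/-- `C(n+4, 4) = (n+4)(n+3)(n+2)(n+1)/24` in `ℚ`. -/
lemma cast_choose_four_add (n : ℕ) :
    ((n + 4).choose 4 : ℚ) = ((n : ℚ) + 4) * ((n : ℚ) + 3) * ((n : ℚ) + 2) * ((n : ℚ) + 1) / 24 := by
  rw [Nat.cast_choose_eq_ascPochhammer_div]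
  simp [ascPochhammer_succ_eval, Nat.factorial]
  ring

/-- **(FIN) for `k = 11`** (`K = 9`, `m ≥ 111`): `9·(2J_2) ≤ 4/5` and `C(20,10)·(1 + q/100)/C(m+5, 4) ≤ 1/5`. -/
lemma fin_nine (m : ℕ) (hm : 111 ≤ m) :
    ((2 * 9 + 2).choose (9 + 1) : ℚ) * (1 + ((m : ℚ) + 1 + 9) / ((9 : ℚ) + 1) ^ 2)
        / ((m + 9 / 2 + 1).choose (9 / 2) : ℚ)
      ≤ 1 - (9 : ℚ) * (2 * sliceS (m + 1) m 2) := by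
  have hρ := diag_two_sq_le m
  have hρ0 : (0 : ℚ) ≤ 2 * sliceS (m + 1) m 2 := by
    have := sliceS_nonneg (m + 1) m 2; positivity
  have hm' : (111 : ℚ) ≤ m := by exact_mod_cast hm
  have h1 : (9 : ℚ) * (2 * sliceS (m + 1) m 2) ≤ 4 / 5 := by
    have hsq : (9 * (2 * sliceS (m + 1) m 2)) ^ 2 ≤ (4 / 5) ^ 2 := by
      calc (9 * (2 * sliceS (m + 1) m 2)) ^ 2 = 81 * (2 * sliceS (m + 1) m 2) ^ 2 := by ring
        _ ≤ 81 * (8 / (9 * ((m : ℚ) + 2))) := by gcongr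
        _ ≤ (4 / 5) ^ 2 := by
            rw [show (81 : ℚ) * (8 / (9 * ((m : ℚ) + 2))) = 72 / ((m : ℚ) + 2) by field_simp; ring,
              div_le_iff₀ (by positivity)]
            nlinarith
    nlinarith [hsq, hρ0]
  have h2 : ((2 * 9 + 2).choose (9 + 1) : ℚ) * (1 + ((m : ℚ) + 1 + 9) / ((9 : ℚ) + 1) ^ 2)
        / ((m + 9 / 2 + 1).choose (9 / 2) : ℚ) ≤ 1 / 5 := by
    rw [show Nat.choose (2 * 9 + 2) (9 + 1) = 184756 by decide, show (9 : ℕ) / 2 = 4 from rfl,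
      show m + 4 + 1 = m + 1 + 4 by ring, cast_choose_four_add]
    push_cast
    rw [div_le_iff₀ (by positivity)]
    nlinarith [mul_nonneg (sub_nonneg.mpr hm') (sub_nonneg.mpr hm'),
      mul_nonneg (mul_nonneg (sub_nonneg.mpr hm') (sub_nonneg.mpr hm')) (sub_nonneg.mpr hm')]
  linarith [h1, h2]

/-- `C(2(n+1), n+1) ≤ 4·C(2n, n)` (`Nat.succ_mul_centralBinom_succ`). -/
lemma choose_two_mul_succ_le (n : ℕ) : (2 * (n + 1)).choose (n + 1) ≤ 4 * (2 * n).choose n := by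
  have h := Nat.succ_mul_centralBinom_succ n
  rw [Nat.centralBinom_eq_two_mul_choose, Nat.centralBinom_eq_two_mul_choose] at h
  have : (n + 1) * (2 * (n + 1)).choose (n + 1) ≤ (n + 1) * (4 * (2 * n).choose n) := by
    rw [h]; nlinarith
  exact Nat.le_of_mul_le_mul_left this (by omega)

/-- **The `k`-recursion of (FIN)** `tK`: for `K ≥ 10` and `d = ⌊K/2⌋`,
`54·C(2K+2, K+1)·d ≤ (K+1)²·C(K² + 3K + 3 + d, d − 1)` (two-step induction: the left side grows by `< 16·6/5`
per `K ↦ K + 2`, the right side by `≥ 2K + 6`). -/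
lemma tK (K : ℕ) (hK : 10 ≤ K) :
    54 * (2 * K + 2).choose (K + 1) * (K / 2) ≤ (K + 1) ^ 2 * (K * K + 3 * K + 3 + K / 2).choose (K / 2 - 1) := by
  obtain ⟨n, rfl⟩ : ∃ n, K = 10 + n := ⟨K - 10, by omega⟩
  clear hK
  induction n using Nat.twoStepInduction with
  | zero =>
    rw [show Nat.choose (2 * (10 + 0) + 2) (10 + 0 + 1) = 705432 by decide]
    rw [show (10 + 0) / 2 = 5 from rfl, show (10 + 0) * (10 + 0) + 3 * (10 + 0) + 3 + 5 = 138 from rfl,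
      show (5 : ℕ) - 1 = 4 from rfl, show Nat.choose 138 4 = 14463090 by
        rw [Nat.choose_eq_descFactorial_div_factorial]; norm_num [Nat.descFactorial, Nat.factorial]]
    norm_num
  | one =>
    rw [show Nat.choose (2 * (10 + 1) + 2) (10 + 1 + 1) = 2704156 by decide]
    rw [show (10 + 1) / 2 = 5 from rfl, show (10 + 1) * (10 + 1) + 3 * (10 + 1) + 3 + 5 = 162 from rfl,
      show (5 : ℕ) - 1 = 4 from rfl, show Nat.choose 162 4 = 27646920 by
        rw [Nat.choose_eq_descFactorial_div_factorial]; norm_num [Nat.descFactorial, Nat.factorial]]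
    norm_num
  | more n ih _ =>
    set K := 10 + n with hKdef
    have hK : 10 ≤ K := by omega
    rw [show 10 + (n + 2) = K + 2 by omega]
    set d := K / 2 with hd
    have hd5 : 5 ≤ d := by omega
    have hd2 : (K + 2) / 2 = d + 1 := by omega
    rw [hd2, show d + 1 - 1 = d by omega]
    -- the binomial growth: C(2K+6, K+3) ≤ 16·C(2K+2, K+1)
    have hA : (2 * (K + 2) + 2).choose (K + 2 + 1) ≤ 16 * (2 * K + 2).choose (K + 1) := by
      have e1 := choose_two_mul_succ_le (K + 1)
      have e2 := choose_two_mul_succ_le (K + 2)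
      rw [show 2 * (K + 1) = 2 * K + 2 by ring] at e1
      rw [show 2 * (K + 2) + 2 = 2 * (K + 2 + 1) by ring]
      rw [show 2 * (K + 1 + 1) = 2 * (K + 2) by ring, show K + 1 + 1 = K + 2 by ring] at e1
      omega
    -- the binomial on the right: C((K+2)² + 3(K+2) + 3 + d + 1, d) ≥ (2K+6)·C(K² + 3K + 3 + d, d − 1)
    have hB : (2 * K + 6) * (K * K + 3 * K + 3 + d).choose (d - 1)
        ≤ ((K + 2) * (K + 2) + 3 * (K + 2) + 3 + (d + 1)).choose d := by
      have e1 := Nat.add_one_mul_choose_eq (K * K + 3 * K + 3 + d) (d - 1)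
      rw [show d - 1 + 1 = d by omega] at e1
      -- e1 : (K²+3K+3+d+1) * C(K²+3K+3+d, d−1) = C(K²+3K+3+d+1, d) * d
      have e2 : (K * K + 3 * K + 3 + d + 1).choose d
          ≤ ((K + 2) * (K + 2) + 3 * (K + 2) + 3 + (d + 1)).choose d :=
        Nat.choose_le_choose d (by nlinarith)
      have h2d : 2 * d ≤ K := by omega
      have e3 : (2 * K + 6) * d ≤ K * K + 3 * K + 3 + d + 1 := by nlinarith [h2d]
      calc (2 * K + 6) * (K * K + 3 * K + 3 + d).choose (d - 1)
          ≤ (K * K + 3 * K + 3 + d + 1) * (K * K + 3 * K + 3 + d).choose (d - 1) / d := by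
            rw [Nat.le_div_iff_mul_le (by omega)]
            nlinarith
        _ = (K * K + 3 * K + 3 + d + 1).choose d := by
            rw [e1, Nat.mul_div_cancel _ (by omega)]
        _ ≤ _ := e2
    -- assemble: 5·LHS' ≤ 96·LHS ≤ 96·RHS ≤ 5·RHS'
    have h5 : 5 * (54 * (2 * (K + 2) + 2).choose (K + 2 + 1) * (d + 1))
        ≤ 96 * (54 * (2 * K + 2).choose (K + 1) * d) := by
      have : 5 * (d + 1) ≤ 6 * d := by omega
      nlinarith [hA, this]
    have h6 : 96 * ((K + 1) ^ 2 * (K * K + 3 * K + 3 + d).choose (d - 1))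
        ≤ 5 * ((K + 2 + 1) ^ 2 * ((K + 2) * (K + 2) + 3 * (K + 2) + 3 + (d + 1)).choose d) := by
      have hKK : (K + 1) ^ 2 ≤ (K + 2 + 1) ^ 2 := by nlinarith
      have hB' : 130 * (K * K + 3 * K + 3 + d).choose (d - 1)
          ≤ 5 * ((K + 2) * (K + 2) + 3 * (K + 2) + 3 + (d + 1)).choose d := by
        calc 130 * (K * K + 3 * K + 3 + d).choose (d - 1)
            ≤ 5 * ((2 * K + 6) * (K * K + 3 * K + 3 + d).choose (d - 1)) := by nlinarith
          _ ≤ _ := by nlinarith [hB]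
      nlinarith [hB', hKK]
    omega

/-- **(FIN) for `k ≥ 12`** (`K ≥ 10`, `m ≥ k² − k + 1 = K² + 3K + 3`): `K·(2J_2) ≤ 17/18` and the right side is `≤ 1/18`
through `tK`. -/
lemma fin_ten_up (K m : ℕ) (hK : 10 ≤ K) (hm : K * K + 3 * K + 3 ≤ m) :
    ((2 * K + 2).choose (K + 1) : ℚ) * (1 + ((m : ℚ) + 1 + K) / ((K : ℚ) + 1) ^ 2)
        / ((m + K / 2 + 1).choose (K / 2) : ℚ)
      ≤ 1 - (K : ℚ) * (2 * sliceS (m + 1) m 2) := by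
  set d := K / 2 with hd
  have hd5 : 5 ≤ d := by omega
  have hρ := diag_two_sq_le m
  have hρ0 : (0 : ℚ) ≤ 2 * sliceS (m + 1) m 2 := by
    have := sliceS_nonneg (m + 1) m 2; positivity
  have hmK : ((K : ℚ) + 1) ^ 2 ≤ m := by
    have : (K + 1) ^ 2 ≤ m := by nlinarith
    exact_mod_cast this
  have hK1 : (K : ℚ) + 1 ≤ m := by
    have : K + 1 ≤ m := by nlinarith
    exact_mod_cast this
  have hKq : (10 : ℚ) ≤ K := by exact_mod_cast hK
  -- the left side: K·(2J_2) ≤ 17/18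
  have h1 : (K : ℚ) * (2 * sliceS (m + 1) m 2) ≤ 17 / 18 := by
    have hsq : ((K : ℚ) * (2 * sliceS (m + 1) m 2)) ^ 2 ≤ (17 / 18) ^ 2 := by
      calc ((K : ℚ) * (2 * sliceS (m + 1) m 2)) ^ 2 = (K : ℚ) ^ 2 * (2 * sliceS (m + 1) m 2) ^ 2 := by ring
        _ ≤ (K : ℚ) ^ 2 * (8 / (9 * ((m : ℚ) + 2))) := by gcongr
        _ ≤ (17 / 18) ^ 2 := by
            rw [show (K : ℚ) ^ 2 * (8 / (9 * ((m : ℚ) + 2))) = 8 * (K : ℚ) ^ 2 / (9 * ((m : ℚ) + 2)) by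
              field_simp, div_le_iff₀ (by positivity)]
            nlinarith
    nlinarith [hsq, hρ0]
  -- the right side: ≤ 1/18
  have hT := tK K hK
  rw [← hd] at hT
  have hTq : (54 : ℚ) * ((2 * K + 2).choose (K + 1) : ℚ) * (d : ℚ)
      ≤ ((K : ℚ) + 1) ^ 2 * ((K * K + 3 * K + 3 + d).choose (d - 1) : ℚ) := by exact_mod_cast hT
  have hmono : ((K * K + 3 * K + 3 + d).choose (d - 1) : ℚ) ≤ ((m + d).choose (d - 1) : ℚ) := by
    exact_mod_cast Nat.choose_le_choose (d - 1) (by omega)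
  have hstep := Nat.add_one_mul_choose_eq (m + d) (d - 1)
  rw [show d - 1 + 1 = d by omega] at hstep
  have hstepq : ((m : ℚ) + d + 1) * ((m + d).choose (d - 1) : ℚ) = ((m + d + 1).choose d : ℚ) * (d : ℚ) := by
    exact_mod_cast hstep
  have hB : (0 : ℚ) < ((m + d + 1).choose d : ℚ) := Nat.cast_pos.mpr (Nat.choose_pos (by omega))
  have hB' : (0 : ℚ) ≤ ((m + d).choose (d - 1) : ℚ) := by positivity
  have hd0 : (0 : ℚ) < d := by exact_mod_cast (show 0 < d by omega)
  have hC0 : (0 : ℚ) ≤ ((2 * K + 2).choose (K + 1) : ℚ) := by positivity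
  have hm0 : (0 : ℚ) < m := by linarith
  -- 1 + q/(K+1)² ≤ 3m/(K+1)²
  have hg : 1 + ((m : ℚ) + 1 + K) / ((K : ℚ) + 1) ^ 2 ≤ 3 * (m : ℚ) / ((K : ℚ) + 1) ^ 2 := by
    rw [show (1 : ℚ) + ((m : ℚ) + 1 + K) / ((K : ℚ) + 1) ^ 2
        = (((K : ℚ) + 1) ^ 2 + ((m : ℚ) + 1 + K)) / ((K : ℚ) + 1) ^ 2 by field_simp]
    exact div_le_div_of_nonneg_right (by linarith) (by positivity)
  -- C(m+d+1, d) ≥ 54·C(2K+2,K+1)·m/(K+1)²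
  have hBig : (54 : ℚ) * ((2 * K + 2).choose (K + 1) : ℚ) * (m : ℚ) ≤ ((K : ℚ) + 1) ^ 2 * ((m + d + 1).choose d : ℚ) := by
    have e1 : ((m + d + 1).choose d : ℚ) * (d : ℚ) ≥ (m : ℚ) * ((m + d).choose (d - 1) : ℚ) := by
      rw [← hstepq]; nlinarith
    have e2 : (54 : ℚ) * ((2 * K + 2).choose (K + 1) : ℚ) * (d : ℚ) * (m : ℚ)
        ≤ ((K : ℚ) + 1) ^ 2 * ((m + d).choose (d - 1) : ℚ) * (m : ℚ) := by
      have := mul_le_mul_of_nonneg_right (hTq.trans (mul_le_mul_of_nonneg_left hmono (by positivity))) hm0.le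
      linarith
    nlinarith [e1, e2, hd0]
  have h2 : ((2 * K + 2).choose (K + 1) : ℚ) * (1 + ((m : ℚ) + 1 + K) / ((K : ℚ) + 1) ^ 2)
        / ((m + d + 1).choose d : ℚ) ≤ 1 / 18 := by
    rw [div_le_iff₀ hB]
    calc ((2 * K + 2).choose (K + 1) : ℚ) * (1 + ((m : ℚ) + 1 + K) / ((K : ℚ) + 1) ^ 2)
        ≤ ((2 * K + 2).choose (K + 1) : ℚ) * (3 * (m : ℚ) / ((K : ℚ) + 1) ^ 2) :=
          mul_le_mul_of_nonneg_left hg hC0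
      _ = (54 * ((2 * K + 2).choose (K + 1) : ℚ) * (m : ℚ)) / (18 * ((K : ℚ) + 1) ^ 2) := by
          field_simp; ring
      _ ≤ (((K : ℚ) + 1) ^ 2 * ((m + d + 1).choose d : ℚ)) / (18 * ((K : ℚ) + 1) ^ 2) :=
          div_le_div_of_nonneg_right hBig (by positivity)
      _ = 1 / 18 * ((m + d + 1).choose d : ℚ) := by field_simp
  linarith [h1, h2]

/-! ### §4 The theorems -/

/-- **THE LARGE-q HALF OF THE FIRST UNTRUNCATED SLICE**: for `k = K + 2 ≥ 11` and `q = m + 1 + K ≥ k²`,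
`Φ(q+k, q) ≤ R̂(q, k, m)` (the slice `u = k − 1`). -/
theorem first_untrunc_large (K m : ℕ) (hK : 9 ≤ K) (hm : K * K + 3 * K + 3 ≤ m) :
    phiK (m + 1 + K + (K + 2)) (m + 1 + K) ≤ rhat (m + 1 + K) (K + 2) m := by
  apply first_untrunc_of_core K m (by omega)
  apply core_of_fin K m (by omega)
  rcases Nat.lt_or_ge K 10 with h | h
  · have hK9 : K = 9 := by omega
    subst hK9
    exact fin_nine m (by omega)
  · exact fin_ten_up K m h hm

/-- **THE FIRST UNTRUNCATED SLICE `u = k − 1` IS PAID ON EVERY CELL OF EVERY FAMILY `k ≥ 5`**: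
`Φ(q+k, q) ≤ R̂(q, k, q − (k−1))` for every `q ≥ k − 1` (`k ≤ 10`: `rhat_slice_iff_all_ten`; `k ≥ 11`, `q ≤ k² − 1`:
`first_untrunc_slice_complete`; `k ≥ 11`, `q ≥ k²`: `first_untrunc_large`). -/
theorem first_untrunc_slice_every (k q : ℕ) (hk : 5 ≤ k) (hq : k - 1 ≤ q) :
    phiK (q + k) q ≤ rhat q k (q - (k - 1)) := by
  rcases Nat.lt_or_ge k 11 with h10 | h11
  · exact ((rhat_slice_iff_all_ten k (k - 1) hk (by omega)).mpr (Or.inr (by omega))) q hq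
  · rcases Nat.lt_or_ge q (k * k) with hsmall | hlarge
    · exact first_untrunc_slice_complete k q hk hq (by omega)
    · obtain ⟨K, rfl⟩ : ∃ K, k = K + 2 := ⟨k - 2, by omega⟩
      obtain ⟨m, rfl⟩ : ∃ m, q = m + 1 + K := ⟨q - 1 - K, by omega⟩
      rw [show m + 1 + K - (K + 2 - 1) = m by omega]
      exact first_untrunc_large K m (by omega) (by nlinarith)

/-- **The slice map entry `u = k − 1`, every family `k ≥ 5`**: the slice is paid on every cell (the form of
`rhat_slice_iff_all_ten`'s left side). -/
theorem rhat_first_untrunc_slice (k : ℕ) (hk : 5 ≤ k) :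
    ∀ q, k - 1 ≤ q → phiK (q + k) q ≤ rhat q k (q - (k - 1)) :=
  fun q hq => first_untrunc_slice_every k q hk hq

/-- **THE MATROID LEVEL**: at the tight layer `#E = (q+k) + q` of every finite matroid, every member `Z` of the cell
`(q+k, q)` with `#(flatPart M Z) = q − (k − 1)` receives at least `Φ(q+k, q)` under Rule Q's equal split, for every
`k ≥ 5` and every `q ≥ k − 1`. -/
theorem ruleQRecv_ge_phiK_first_untrunc_every {β : Type} (M : Matroid β) [M.Finite] {q k : ℕ} (hk : 5 ≤ k)
    (hq : k - 1 ≤ q) (hE : M.E.ncard = (q + k) + q) {Z : Set β} (hZ : Z ∈ cellMembers M (q + k) q)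
    (hP : (flatPart M Z).ncard = q - (k - 1)) :
    phiK (q + k) q ≤ ruleQRecv M (q + k) q Z := by
  have h1 := first_untrunc_slice_every k q hk hq
  have h2 := rhat_le_ruleQRecv M hE hZ
  rw [hP] at h2
  exact h1.trans h2

end PercRepro
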